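/-
Copyright (c) 2026 the pub-hodgecm-mathlib formalisation cell (harness21).  Prover seat hodgecm-mathlib-K2E3-p12 (g6): Track B «K2-LIT», ENGINE E1 (on loan
per chair word «β → E1»), h413 = stmt-HodgeConjecture-24833; campaign «EIS-WHITTAKER-2», letter «W-hWbd» (K2E1-plan (g4) deal 07:52:48Z, FINAL RULING g4 «W5 DIVISION» 07:56:16Z),
FILE C2 of the assembly: the GLOBAL FINITE PART of the Whittaker coefficient at the idele-twisted frequency `ξ·u`, as one entire function of `z` per `ξ`, with its box, bound and support.
-/
import Summits.HodgeConjecture.HodgeConjecture.Theorems.K2E1LocalWhittakerPackageU2         -- ★ p858471 FILE C1 (this seat): the sharp per-place package, finite-idele bookkeeping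
import Summits.HodgeConjecture.HodgeConjecture.Theorems.K2E1AdelicFourierCoeffEulerProduct     -- ★ p858348 W3 FILE 1 (this seat): `algebraMap_mul_apply` ((ξb)_v = ξ·b_v)
import Summits.HodgeConjecture.HodgeConjecture.Theorems.K2E1WhittakerBoundsUniformU2        -- ★ p858401 #1b (K2E2-p12 g5): the product-formula bound `∏ 2(n_v+1) ≤ C·(1+‖ξ_∞‖)^{2[F:ℚ]}`
import Literature.NumberTheory.Automorphic.AdeleAddCharLocalComponentsUnramified             -- ★ `IsGlobalAddChar.exists_hasConductorExp_adicComponent` (conductor letters `m_v`)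
import Literature.NumberTheory.Automorphic.GlobalAdditiveCharacterProofs                     -- ★ `eventually_hasConductorExp_zero_adicComponent_adeleAddChar` (`m_v = 0` a.e.)
import HarnessLib

/-!
# K2·E1 — `K2E1WhittakerFinitePartU2` («EIS-WHITTAKER-2», letter «W-hWbd», FILE C2): THE GLOBAL FINITE PART `W_f(z,ξ) = ∏_{v ∈ S(ξ)} W^c_v(ξ·u_v, z)` AT THE IDELE-TWISTED
# FREQUENCY `η = ξ·u` — ENTIRE in `z`, EQUAL to the product of the local Whittaker integrals on `Re z > ½`, `= 1 − q_v^{−2z}` off `S(ξ)`, BOUNDED by `C·(1+‖ξ_∞‖)^{2[F:ℚ]}` on the box, ZERO off it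

Track B ∕ K2-LIT, crux h413 = `stmt-HodgeConjecture-24833`, route of record `HCCMUnconditional`; cell `hodgecm-mathlib`, squad K2, ENGINE E1.  THEOREMS ONLY (no `def`, no instance, no notation,
no named-fact hypothesis, no `sorry`; default heartbeats); lane `--supports stmt-HodgeConjecture-24833 --as helper` (count-neutral, closes no socket).  GENERIC quadratic `E ∕ F` of number fields,
`δ ∈ E ∖ 0`, Tate's local characters `ψ_v = adeleAddCharAt F v`, a finite idele `u` (`u·u' = 1`; in the assembly `u = (α_F⁻¹)_f` for W3-cov ★ p858333's line idele `α_F`), ANY Haar family `ν_v`.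

THE MATHEMATICS [Tate1950 §2.5, §4.1; Garrett2018 §1.10, §2.8; Bump1997 §3.7].  LETTERS (chosen once, CONSTANTS-FIRST, then hidden behind `∃`): conductor exponents `m_v` of `ψ_v` (★, `= 0` a.e. ★),
base balls `a_v` (★ p858404 `exists_baseBall` on `S_δ`, `0` off `S_δ`), the local orders `o_v` of `u` (`‖u_v‖ = (q_v⁻¹)^{o_v}` ★ FILE C1, `= 0` a.e.), the BOX exponents **`e_v := m_v − a_v − o_v`**
(`= 0` a.e.), `S₀ := S_δ ∪ supp m ∪ supp o`, and for `ξ ≠ 0` the finite set **`S(ξ) := S₀ ∪ {v : ‖ξ·u_v‖_v ≠ 1}`** (finite: `ξ·u` is a finite idele).  With `W^c_v(ξ)` the package of ★ FILE C1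
`exists_entire_localWhittaker_sharp` at `η_v = ξ·u_v` define `W_f(z, ξ) := ∏_{v ∈ S(ξ)} W^c_v(ξ)(z)`.  HEAD **`exists_whittakerFinitePart`**: `∃ W_f S e` with
 (0) `e_v = 0` for almost all `v`; (hol) every `z ↦ W_f(z,ξ)` ENTIRE; (eq) `ξ ≠ 0`, `Re z > ½` ⟹ `W_f(z,ξ) = ∏_{v∈S(ξ)} ν_v(𝒪_v)⁻¹·∫ P_v(t)^{−z}·ψ_v((ξ·u_v)·t) dν_v(t)` (the `∏_{v∈S} W_v` token of ★ FILE 4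
 `…_eq_prod_cm_two_of_one_lt_re`∕`_mellin`); (unr) `ξ ≠ 0`, `v ∉ S(ξ)`, `Re z > ½` ⟹ `ν_v(𝒪_v)⁻¹·∫ P_v^{−z}ψ_v((ξu_v)t) = 1 − q_v^{−2z}` (★ FILE A §3 — the NAMED `hW` of ★ FILE 4, DISCHARGED);
 (bd) ONE `C ≥ 0` with `‖W_f(z,ξ)‖ ≤ C·(1 + ‖mixedEmbedding F ξ‖)^{2[F:ℚ]}` for ALL `Re z ≥ ½` and all `ξ ≠ 0` in the box `∀ v, (ξ : F_v) ∈ 𝔭_v^{e_v}` (★ C1 sharp packages × ★ #1b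
 `exists_prod_two_mul_succ_le_of_mem_primePowBall` with THIS `e` and `S₀`; off `S₀` the order of `η_v` is `≥ 1` because `‖η_v‖ < 1`); (supp) `ξ ≠ 0` with `(ξ : F_v) ∉ 𝔭_v^{e_v}` for some `v` ⟹
 `W_f(z,ξ) = 0` for all `z` (that `v` lies in `S(ξ)` and its package vanishes below the threshold, ★ C1 (iii) with the ball dictionary `ξu_v ∈ 𝔭^{m−a} ↔ ξ ∈ 𝔭^{m−a−o}`).
HONEST LABEL: HC_CM is proved only modulo the 7 printed citations (2 remaining named inputs: hLiu418 = `stmt-HodgeConjecture-24832`, h413 = `stmt-HodgeConjecture-24833`) until rung 0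
closes; this file asserts no named fact and closes no socket; count-neutral.

## References
* [Tate1950] J. Tate, *Fourier analysis in number fields and Hecke's zeta-functions* (1950), §2.5, §4.1.
* [Garrett2018] P. Garrett, *Modern Analysis of Automorphic Forms by Example* 1 (2018), §1.10, §2.8.
* [Bump1997] D. Bump, *Automorphic Forms and Representations* (1997), §3.7.
-/

set_option autoImplicit false
set_option linter.dupNamespace false -- the mandated namespace repeats `HodgeConjecture.HodgeConjecture`

noncomputable section

open MeasureTheory Filter Topology Set NumberField NumberField.mixedEmbedding IsDedekindDomain IsDedekindDomain.HeightOneSpectrum Module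
open scoped NNReal ENNReal Classical
open Literature.NumberTheory.GaloisRepresentations.IsNonarchimedeanLocalField
open Literature.NumberTheory.Automorphic Literature.NumberTheory.Automorphic.LocalFieldHaar
open Summit.HodgeConjecture.HodgeConjecture.Cruxes.H413.K2E1FiniteWhittakerStepSymbolLine (exists_baseBall)
open Summit.HodgeConjecture.HodgeConjecture.Cruxes.H413.K2E1IntertwiningLocalFactorU2Height (normAbs_adicCompletionSemialgHom)
open Summit.HodgeConjecture.HodgeConjecture.Cruxes.H413.K2E1IntertwiningLocalFactorU2Line (finite_setOf_exists_extension_normAbs_ne_one)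
open Summit.HodgeConjecture.HodgeConjecture.Cruxes.H413.K2E1WhittakerBoundsUniformU2 (exists_prod_two_mul_succ_le_of_mem_primePowBall)
open Summit.HodgeConjecture.HodgeConjecture.Cruxes.H413.K2E1LocalWhittakerContinuationU2
open Summit.HodgeConjecture.HodgeConjecture.Cruxes.H413.K2E1LocalWhittakerPackageU2

namespace Summit.HodgeConjecture.HodgeConjecture.Cruxes.H413.K2E1WhittakerFinitePartU2

variable {F E : Type} [Field F] [NumberField F] [Field E] [NumberField E] [Algebra F E] [Algebra.IsQuadraticExtension F E] {δ : E}

/-! ## §1 Letters: conductor exponents, base balls, local orders of the idele -/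

/-- **Conductor letters**: `m_v` with `(ψ_v).HasConductorExp m_v` for every `v`, and `m_v = 0` for almost all `v` (★ existence at every place, ★ `= 0` off the different, ★ uniqueness).
[cite: Tate1950, §2.2] -/
theorem exists_conductorExps (F : Type) [Field F] [NumberField F] :
    ∃ m : HeightOneSpectrum (𝓞 F) → ℤ, (∀ v, (adeleAddCharAt F v).HasConductorExp (m v)) ∧ ∀ᶠ v in cofinite, m v = 0 := by
  have h : ∀ v : HeightOneSpectrum (𝓞 F), ∃ m : ℤ, (adeleAddCharAt F v).HasConductorExp m := fun v =>
    (isGlobalAddChar_adeleAddChar F).exists_hasConductorExp_adicComponent v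
  choose m hm using h
  exact ⟨m, hm, (eventually_hasConductorExp_zero_adicComponent_adeleAddChar (K := F)).mono fun v h0 => (hm v).unique h0⟩

omit [Algebra.IsQuadraticExtension F E] in
/-- **Base-ball letters**: `a_v` with `‖ι_w t‖_w·‖δ‖_w ≤ 1` on `𝔭^{a_v}` for all `w ∣ v` (★ `exists_baseBall`), chosen `= 0` wherever `‖δ‖_w = 1` for all `w ∣ v` — so `a_v = 0` for almost all `v`
(★ `finite_setOf_exists_extension_normAbs_ne_one`). [cite: Tate1950, §2.5] -/
theorem exists_baseBalls (hδ : δ ≠ 0) :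
    ∃ a : HeightOneSpectrum (𝓞 F) → ℤ,
      (∀ (v : HeightOneSpectrum (𝓞 F)) (w : v.Extension (𝓞 E)) (t : v.adicCompletion F), t ∈ primePowBall (v.adicCompletion F) (a v) →
        normAbs (w.1.adicCompletion E) (Extension.adicCompletionSemialgHom F E w t) * normAbs (w.1.adicCompletion E) ((algebraMap E (FiniteAdeleRing (𝓞 E) E) δ) w.1) ≤ 1) ∧
      (∀ v : HeightOneSpectrum (𝓞 F), (∀ w : v.Extension (𝓞 E), normAbs (w.1.adicCompletion E) ((algebraMap E (FiniteAdeleRing (𝓞 E) E) δ) w.1) = 1) → a v = 0) ∧ ∀ᶠ v in cofinite, a v = 0 := by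
  have hb : ∀ v : HeightOneSpectrum (𝓞 F), ∃ a : ℤ, ∀ (w : v.Extension (𝓞 E)) (t : v.adicCompletion F), t ∈ primePowBall (v.adicCompletion F) a →
      normAbs (w.1.adicCompletion E) (Extension.adicCompletionSemialgHom F E w t) * normAbs (w.1.adicCompletion E) ((algebraMap E (FiniteAdeleRing (𝓞 E) E) δ) w.1) ≤ 1 := fun v =>
    exists_baseBall (E := E) (δ := δ) v
  choose b hb using hb
  refine ⟨fun v => if (∀ w : v.Extension (𝓞 E), normAbs (w.1.adicCompletion E) ((algebraMap E (FiniteAdeleRing (𝓞 E) E) δ) w.1) = 1) then 0 else b v, fun v w t ht => ?_, fun v hv => if_pos hv, ?_⟩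
  · by_cases hv : (∀ w : v.Extension (𝓞 E), normAbs (w.1.adicCompletion E) ((algebraMap E (FiniteAdeleRing (𝓞 E) E) δ) w.1) = 1)
    · dsimp only at ht
      rw [if_pos hv] at ht
      rw [hv w, mul_one, normAbs_adicCompletionSemialgHom F E v w t]
      have h1 : normAbs (v.adicCompletion F) t ≤ 1 := by rw [mem_primePowBall_iff, zpow_zero] at ht; exact ht
      exact pow_le_one₀ (normAbs (v.adicCompletion F) t).2 h1
    · dsimp only at ht
      rw [if_neg hv] at ht
      exact hb v w t ht
  · refine (Filter.eventually_cofinite.2 ((finite_setOf_exists_extension_normAbs_ne_one (F := F) (E := E) hδ).subset fun v hv => ?_)).mono fun v hv => if_pos hv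
    by_contra h
    exact hv fun w => not_not.1 fun hw => h ⟨w, hw⟩

/-- **Order letters of a finite idele**: `o_v` with `‖u_v‖_v = (q_v⁻¹)^{o_v}`, `= 0` for almost all `v` (★ FILE C1). [folklore] -/
theorem exists_orders {u u' : FiniteAdeleRing (𝓞 F) F} (huu' : u * u' = 1) :
    ∃ o : HeightOneSpectrum (𝓞 F) → ℤ, (∀ v, normAbs (v.adicCompletion F) (u v) = (residueFieldCard (v.adicCompletion F) : ℝ≥0)⁻¹ ^ (o v)) ∧ ∀ᶠ v in cofinite, o v = 0 := by
  choose o ho using exists_int_normAbs_apply_eq huu'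
  refine ⟨o, ho, (eventually_normAbs_apply_eq_one huu').mono fun v hv => ?_⟩
  rw [ho v] at hv
  exact (zpow_eq_one_iff_right₀ inv_residueFieldCard_pos.le inv_residueFieldCard_lt_one.ne).1 hv

/-- **The twisted frequency `ξ·u` is a finite idele for `ξ ≠ 0`**: `‖ξ·u_v‖_v = 1` for almost all `v` (its inverse is `ξ⁻¹·u'`). [folklore] -/
theorem finite_setOf_normAbs_mul_ne_one {u u' : FiniteAdeleRing (𝓞 F) F} (huu' : u * u' = 1) {ξ : F} (hξ : ξ ≠ 0) :
    {v : HeightOneSpectrum (𝓞 F) | normAbs (v.adicCompletion F) ((ξ : v.adicCompletion F) * u v) ≠ 1}.Finite := by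
  have h : (algebraMap F (FiniteAdeleRing (𝓞 F) F) ξ * u) * (algebraMap F (FiniteAdeleRing (𝓞 F) F) ξ⁻¹ * u') = 1 := by
    rw [mul_mul_mul_comm, ← map_mul, mul_inv_cancel₀ hξ, map_one, one_mul, huu']
  refine (Filter.eventually_cofinite.1 (eventually_normAbs_apply_eq_one h)).subset fun v hv => ?_
  rw [mem_setOf_eq] at hv ⊢
  rwa [K2E1AdelicFourierCoeffEulerProduct.algebraMap_mul_apply]

/-- Off `S₀` a twisted frequency of norm `≠ 1` lying in `𝒪_v` has norm `< 1`, hence its order `n` above `𝔭⁰` is `≥ 1`. [folklore] -/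
theorem one_le_of_normAbs_ne_one {v : HeightOneSpectrum (𝓞 F)} {x : v.adicCompletion F} (hx1 : normAbs (v.adicCompletion F) x ≠ 1) {τ : ℤ} (hτ : τ = 0) {n : ℕ}
    (hn : x ∈ primePowBall (v.adicCompletion F) (τ + n)) (hn' : x ∉ primePowBall (v.adicCompletion F) (τ + n + 1)) : 1 ≤ n := by
  subst hτ
  by_contra h
  have hn0 : n = 0 := by omega
  subst hn0
  by_cases hx : x = 0
  · exact hn' (hx ▸ zero_mem_primePowBall _)
  obtain ⟨k, hk⟩ := exists_normAbs_eq_inv_zpow hx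
  have hq0 : (0 : ℝ≥0) < (residueFieldCard (v.adicCompletion F) : ℝ≥0)⁻¹ := inv_residueFieldCard_pos
  have hq1 : (residueFieldCard (v.adicCompletion F) : ℝ≥0)⁻¹ < 1 := inv_residueFieldCard_lt_one
  rw [mem_primePowBall_iff, hk, zpow_le_zpow_iff_right_of_lt_one₀ hq0 hq1] at hn hn'
  have hk0 : k = 0 := by push_cast at hn hn'; omega
  exact hx1 (by rw [hk, hk0, zpow_zero])

/-! ## §2 The global finite part -/

omit [Algebra.IsQuadraticExtension F E] in
/-- `(ξ : F_v) ≠ 0` for `ξ ≠ 0` (the embedding `F → F_v` is a ring map out of a field). [folklore] -/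
theorem coe_adicCompletion_ne_zero {ξ : F} (hξ : ξ ≠ 0) (v : HeightOneSpectrum (𝓞 F)) : (ξ : v.adicCompletion F) ≠ 0 :=
  fun h => hξ ((map_eq_zero_iff (algebraMap F (v.adicCompletion F)) (algebraMap F (v.adicCompletion F)).injective).1 h)

/-- **THE GLOBAL FINITE PART OF THE WHITTAKER COEFFICIENT AT THE IDELE-TWISTED FREQUENCY `ξ·u`** (`u·u' = 1` a finite idele, `δ ≠ 0`, ANY Haar family `ν_v`).  There are
`W_f : ℂ → F → ℂ`, finite sets `S(ξ)` and box exponents `e_v` (`= 0` a.e.) with: (hol) every `z ↦ W_f(z,ξ)` ENTIRE; (eq) for `ξ ≠ 0`, `Re z > ½`: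
`W_f(z,ξ) = ∏_{v∈S(ξ)} ν_v(𝒪_v)⁻¹·∫ P_v(t)^{−z}·ψ_v((ξu_v)t) dν_v`; (unr) for `ξ ≠ 0`, `v ∉ S(ξ)`, `Re z > ½`: `ν_v(𝒪_v)⁻¹·∫ P_v^{−z}ψ_v((ξu_v)t) = 1 − q_v^{−2z}`; (bd) ONE `C ≥ 0`:
`‖W_f(z,ξ)‖ ≤ C·(1+‖mixedEmbedding F ξ‖)^{2[F:ℚ]}` whenever `Re z ≥ ½`, `ξ ≠ 0` and `(ξ : F_v) ∈ 𝔭_v^{e_v}` for all `v`; (supp) `ξ ≠ 0` with `(ξ : F_v) ∉ 𝔭_v^{e_v}` for some `v` ⟹ `W_f(·,ξ) = 0`.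
(Letters §1; packages ★ FILE C1; the bound is ★ #1b `exists_prod_two_mul_succ_le_of_mem_primePowBall` at `e_v = m_v − a_v − o_v`, `S₀ = S_δ ∪ supp m ∪ supp o`.)
[cite: Tate1950, §4.1] [cite: Garrett2018, §2.8] [cite: Bump1997, §3.7] -/
theorem exists_whittakerFinitePart (hδ : δ ≠ 0) [∀ v : HeightOneSpectrum (𝓞 F), MeasurableSpace (v.adicCompletion F)] [∀ v : HeightOneSpectrum (𝓞 F), BorelSpace (v.adicCompletion F)]
    (ν : ∀ v : HeightOneSpectrum (𝓞 F), Measure (v.adicCompletion F)) [∀ v, (ν v).IsAddHaarMeasure] {u u' : FiniteAdeleRing (𝓞 F) F} (huu' : u * u' = 1) :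
    ∃ (Wf : ℂ → F → ℂ) (S : F → Finset (HeightOneSpectrum (𝓞 F))) (e : HeightOneSpectrum (𝓞 F) → ℤ),
      (∀ᶠ v in cofinite, e v = 0) ∧
      (∀ ξ : F, Differentiable ℂ fun z => Wf z ξ) ∧
      (∀ ξ : F, ξ ≠ 0 → ∀ z : ℂ, 1 / 2 < z.re → Wf z ξ = ∏ v ∈ S ξ, ((ν v (v.adicCompletionIntegers F : Set (v.adicCompletion F))).toReal⁻¹ • ∫ t, ((((((letI := Extension.fintype (𝓞 F) F E (𝓞 E) v; ∏ w : v.Extension (𝓞 E), max 1 (normAbs (w.1.adicCompletion E) (Extension.adicCompletionSemialgHom F E w t) * normAbs (w.1.adicCompletion E) ((algebraMap E (FiniteAdeleRing (𝓞 E) E) δ) w.1))) : ℝ≥0) : ℝ) : ℝ) : ℂ) ^ (-z)) * ((adeleAddCharAt F v (((ξ : v.adicCompletion F) * u v) * t) : Circle) : ℂ) ∂ν v)) ∧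
      (∀ ξ : F, ξ ≠ 0 → ∀ v ∉ S ξ, ∀ z : ℂ, 1 / 2 < z.re → ((ν v (v.adicCompletionIntegers F : Set (v.adicCompletion F))).toReal⁻¹ • ∫ t, ((((((letI := Extension.fintype (𝓞 F) F E (𝓞 E) v; ∏ w : v.Extension (𝓞 E), max 1 (normAbs (w.1.adicCompletion E) (Extension.adicCompletionSemialgHom F E w t) * normAbs (w.1.adicCompletion E) ((algebraMap E (FiniteAdeleRing (𝓞 E) E) δ) w.1))) : ℝ≥0) : ℝ) : ℝ) : ℂ) ^ (-z)) * ((adeleAddCharAt F v (((ξ : v.adicCompletion F) * u v) * t) : Circle) : ℂ) ∂ν v) = 1 - (v.residueCard : ℂ) ^ (-(2 * z))) ∧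
      (∃ C : ℝ, 0 ≤ C ∧ ∀ z : ℂ, 1 / 2 ≤ z.re → ∀ ξ : F, ξ ≠ 0 → (∀ v : HeightOneSpectrum (𝓞 F), (ξ : v.adicCompletion F) ∈ primePowBall (v.adicCompletion F) (e v)) →
        ‖Wf z ξ‖ ≤ C * (1 + ‖mixedEmbedding F ξ‖) ^ (2 * finrank ℚ F)) ∧
      (∀ ξ : F, ξ ≠ 0 → (∃ v : HeightOneSpectrum (𝓞 F), (ξ : v.adicCompletion F) ∉ primePowBall (v.adicCompletion F) (e v)) → ∀ z : ℂ, Wf z ξ = 0) := by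
  classical
  obtain ⟨m, hm, hm0⟩ := exists_conductorExps F
  obtain ⟨a, ha, haun, ha0⟩ := exists_baseBalls (F := F) (E := E) hδ
  obtain ⟨o, ho, ho0⟩ := exists_orders huu'
  have hψ : ∀ v : HeightOneSpectrum (𝓞 F), Continuous (adeleAddCharAt F v) := fun v => continuous_adeleAddCharAt F v
  have pkg := fun (v : HeightOneSpectrum (𝓞 F)) (ξ : F) =>
    exists_entire_localWhittaker_sharp (E := E) v (ν v) hδ (ha v) (hψ v) (hm v) ((ξ : v.adicCompletion F) * u v)
  choose Wc hWd hWi hWb hWz using pkg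
  -- the finite sets
  set Sδ : Finset (HeightOneSpectrum (𝓞 F)) := (finite_setOf_exists_extension_normAbs_ne_one (F := F) (E := E) hδ).toFinset with hSδ
  set S₀ : Finset (HeightOneSpectrum (𝓞 F)) := Sδ ∪ (Filter.eventually_cofinite.1 hm0).toFinset ∪ (Filter.eventually_cofinite.1 ho0).toFinset with hS₀
  have hunr : ∀ v ∉ Sδ, (∀ w : v.Extension (𝓞 E), normAbs (w.1.adicCompletion E) ((algebraMap E (FiniteAdeleRing (𝓞 E) E) δ) w.1) = 1) := by
    intro v hv w
    by_contra h
    exact hv ((Set.Finite.mem_toFinset _).2 ⟨w, h⟩)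
  have hS₀m : ∀ v ∉ S₀, m v = 0 := fun v hv => by
    by_contra h; exact hv (Finset.mem_union_left _ (Finset.mem_union_right _ ((Set.Finite.mem_toFinset _).2 h)))
  have hS₀o : ∀ v ∉ S₀, o v = 0 := fun v hv => by
    by_contra h; exact hv (Finset.mem_union_right _ ((Set.Finite.mem_toFinset _).2 h))
  have hS₀δ : ∀ v ∉ S₀, v ∉ Sδ := fun v hv h => hv (Finset.mem_union_left _ (Finset.mem_union_left _ h))
  have hS₀a : ∀ v ∉ S₀, a v = 0 := fun v hv => haun v (hunr v (hS₀δ v hv))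
  let S : F → Finset (HeightOneSpectrum (𝓞 F)) := fun ξ =>
    if hξ : ξ = 0 then S₀ else S₀ ∪ (finite_setOf_normAbs_mul_ne_one huu' hξ).toFinset
  have hS₀S : ∀ ξ, S₀ ⊆ S ξ := fun ξ => by
    by_cases hξ : ξ = 0
    · simp only [S, dif_pos hξ]; exact Finset.Subset.refl _
    · simp only [S, dif_neg hξ]; exact Finset.subset_union_left
  have hSout : ∀ {ξ : F} (hξ : ξ ≠ 0), ∀ v ∉ S ξ, v ∉ S₀ ∧ normAbs (v.adicCompletion F) ((ξ : v.adicCompletion F) * u v) = 1 := by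
    intro ξ hξ v hv
    refine ⟨fun h => hv (hS₀S ξ h), ?_⟩
    by_contra h
    apply hv
    simp only [S, dif_neg hξ]
    exact Finset.mem_union_right _ ((Set.Finite.mem_toFinset _).2 h)
  -- the box exponents
  let e : HeightOneSpectrum (𝓞 F) → ℤ := fun v => m v - a v - o v
  have he0 : ∀ᶠ v in cofinite, e v = 0 := by
    filter_upwards [hm0, ha0, ho0] with v h1 h2 h3
    simp only [e, h1, h2, h3, sub_zero]
  -- the ball dictionary at `η_v = ξ·u_v`
  have hdict : ∀ (ξ : F) (v : HeightOneSpectrum (𝓞 F)) (j : ℤ),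
      (ξ : v.adicCompletion F) * u v ∈ primePowBall (v.adicCompletion F) j ↔ (ξ : v.adicCompletion F) ∈ primePowBall (v.adicCompletion F) (j - o v) :=
    fun ξ v j => mul_mem_primePowBall_iff_of_normAbs_eq (ho v) _ j
  refine ⟨fun z ξ => ∏ v ∈ S ξ, Wc v ξ z, S, e, he0, fun ξ => Differentiable.fun_finsetProd fun v _ => hWd v ξ, fun ξ hξ z hz => ?_, fun ξ hξ v hv z hz => ?_, ?_, fun ξ hξ hv z => ?_⟩
  · -- (eq)
    exact Finset.prod_congr rfl fun v _ => (hWi v ξ (mul_ne_zero (coe_adicCompletion_ne_zero hξ v) (apply_ne_zero_of_mul_eq_one huu' v)) z hz).symm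
  · -- (unr)
    obtain ⟨hv0, hη⟩ := hSout hξ v hv
    have h0 : (adeleAddCharAt F v).HasConductorExp 0 := hS₀m v hv0 ▸ hm v
    exact inv_toReal_measure_smul_integral_lineSymbol_eq_one_sub_of_unramified (E := E) v (ν v) (hunr v (hS₀δ v hv0)) (hψ v) h0 hη hz
  · -- (bd)
    obtain ⟨C₁, hC₁, hbd⟩ := exists_prod_two_mul_succ_le_of_mem_primePowBall (K := F) he0 S₀
    have hBpos : ∀ v : HeightOneSpectrum (𝓞 F), (0 : ℝ) < (if (∀ w : v.Extension (𝓞 E), normAbs (w.1.adicCompletion E) ((algebraMap E (FiniteAdeleRing (𝓞 E) E) δ) w.1) = 1) ∧ a v = 0 then (1 : ℝ) else ((residueFieldCard (v.adicCompletion F) : ℝ) ^ (-(a v)) + (((letI := Extension.fintype (𝓞 F) F E (𝓞 E) v; ∏ w : v.Extension (𝓞 E), min 1 (normAbs (w.1.adicCompletion E) ((algebraMap E (FiniteAdeleRing (𝓞 E) E) δ) w.1))) : ℝ≥0) : ℝ) ^ (-(1 / 2 : ℝ)))) := fun v => localBoundConst_pos (E := E) v hδ (a v)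
    have hB1 : ∀ v ∉ Sδ, (if (∀ w : v.Extension (𝓞 E), normAbs (w.1.adicCompletion E) ((algebraMap E (FiniteAdeleRing (𝓞 E) E) δ) w.1) = 1) ∧ a v = 0 then (1 : ℝ) else ((residueFieldCard (v.adicCompletion F) : ℝ) ^ (-(a v)) + (((letI := Extension.fintype (𝓞 F) F E (𝓞 E) v; ∏ w : v.Extension (𝓞 E), min 1 (normAbs (w.1.adicCompletion E) ((algebraMap E (FiniteAdeleRing (𝓞 E) E) δ) w.1))) : ℝ≥0) : ℝ) ^ (-(1 / 2 : ℝ)))) = 1 := fun v hv => if_pos ⟨hunr v hv, haun v (hunr v hv)⟩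
    refine ⟨(∏ v ∈ Sδ, max 1 (if (∀ w : v.Extension (𝓞 E), normAbs (w.1.adicCompletion E) ((algebraMap E (FiniteAdeleRing (𝓞 E) E) δ) w.1) = 1) ∧ a v = 0 then (1 : ℝ) else ((residueFieldCard (v.adicCompletion F) : ℝ) ^ (-(a v)) + (((letI := Extension.fintype (𝓞 F) F E (𝓞 E) v; ∏ w : v.Extension (𝓞 E), min 1 (normAbs (w.1.adicCompletion E) ((algebraMap E (FiniteAdeleRing (𝓞 E) E) δ) w.1))) : ℝ≥0) : ℝ) ^ (-(1 / 2 : ℝ))))) * C₁, by positivity, fun z hz ξ hξ hbox => ?_⟩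
    show ‖∏ v ∈ S ξ, Wc v ξ z‖ ≤ _
    have hRHS : 0 ≤ (∏ v ∈ Sδ, max 1 (if (∀ w : v.Extension (𝓞 E), normAbs (w.1.adicCompletion E) ((algebraMap E (FiniteAdeleRing (𝓞 E) E) δ) w.1) = 1) ∧ a v = 0 then (1 : ℝ) else ((residueFieldCard (v.adicCompletion F) : ℝ) ^ (-(a v)) + (((letI := Extension.fintype (𝓞 F) F E (𝓞 E) v; ∏ w : v.Extension (𝓞 E), min 1 (normAbs (w.1.adicCompletion E) ((algebraMap E (FiniteAdeleRing (𝓞 E) E) δ) w.1))) : ℝ≥0) : ℝ) ^ (-(1 / 2 : ℝ))))) * C₁ * (1 + ‖mixedEmbedding F ξ‖) ^ (2 * finrank ℚ F) := by positivity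
    rcases em (∃ v ∈ S ξ, (ξ : v.adicCompletion F) * u v ∉ primePowBall (v.adicCompletion F) (m v - a v)) with ⟨v, hvS, hv⟩ | hvan'
    · rw [Finset.prod_eq_zero hvS (by rw [hWz v ξ hv]; rfl), norm_zero]
      exact hRHS
    · have hvan : ∀ v ∈ S ξ, (ξ : v.adicCompletion F) * u v ∈ primePowBall (v.adicCompletion F) (m v - a v) := fun v hv =>
        not_not.1 fun h => hvan' ⟨v, hv, h⟩
      have hn : ∀ v ∈ S ξ, ∃ n : ℕ, (ξ : v.adicCompletion F) * u v ∈ primePowBall (v.adicCompletion F) (m v - a v + n) ∧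
          (ξ : v.adicCompletion F) * u v ∉ primePowBall (v.adicCompletion F) (m v - a v + n + 1) := fun v hv =>
        exists_nat_mem_primePowBall_not_mem (mul_ne_zero (coe_adicCompletion_ne_zero hξ v) (apply_ne_zero_of_mul_eq_one huu' v)) (hvan v hv)
      choose! n hn1 hn2 using hn
      -- the product-formula bound on `∏ 2(n_v + 1)`
      have hcount : ∏ v ∈ S ξ, 2 * ((n v : ℝ) + 1) ≤ C₁ * (1 + ‖mixedEmbedding F ξ‖) ^ (2 * finrank ℚ F) := by
        refine hbd ξ hξ hbox (S ξ) n fun v hv => ⟨?_, ?_, ?_⟩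
        · have h := (hdict ξ v _).1 (hn1 v hv)
          rwa [show m v - a v + (n v : ℤ) - o v = e v + n v by simp only [e]; ring] at h
        · intro h
          refine hn2 v hv ((hdict ξ v _).2 ?_)
          rwa [show m v - a v + (n v : ℤ) + 1 - o v = e v + n v + 1 by simp only [e]; ring]
        · by_cases hv0 : v ∈ S₀
          · exact Or.inl hv0
          · refine Or.inr (one_le_of_normAbs_ne_one (F := F) ?_ (τ := m v - a v) (by rw [hS₀m v hv0, hS₀a v hv0, sub_zero]) (hn1 v hv) (hn2 v hv))
            intro h1
            apply hv0
            by_contra hv0'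
            -- `v ∈ S ξ ∖ S₀` means `‖ξ u_v‖ ≠ 1`
            have : v ∈ (finite_setOf_normAbs_mul_ne_one huu' hξ).toFinset := by
              have hv' := hv
              simp only [S, dif_neg hξ, Finset.mem_union] at hv'
              exact hv'.resolve_left hv0'
            exact ((Set.Finite.mem_toFinset _).1 this) h1
      -- the constants `B_v`
      have hBprod : ∏ v ∈ S ξ, (if (∀ w : v.Extension (𝓞 E), normAbs (w.1.adicCompletion E) ((algebraMap E (FiniteAdeleRing (𝓞 E) E) δ) w.1) = 1) ∧ a v = 0 then (1 : ℝ) else ((residueFieldCard (v.adicCompletion F) : ℝ) ^ (-(a v)) + (((letI := Extension.fintype (𝓞 F) F E (𝓞 E) v; ∏ w : v.Extension (𝓞 E), min 1 (normAbs (w.1.adicCompletion E) ((algebraMap E (FiniteAdeleRing (𝓞 E) E) δ) w.1))) : ℝ≥0) : ℝ) ^ (-(1 / 2 : ℝ)))) ≤ ∏ v ∈ Sδ, max 1 (if (∀ w : v.Extension (𝓞 E), normAbs (w.1.adicCompletion E) ((algebraMap E (FiniteAdeleRing (𝓞 E) E) δ) w.1) = 1) ∧ a v = 0 then (1 : ℝ)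 else ((residueFieldCard (v.adicCompletion F) : ℝ) ^ (-(a v)) + (((letI := Extension.fintype (𝓞 F) F E (𝓞 E) v; ∏ w : v.Extension (𝓞 E), min 1 (normAbs (w.1.adicCompletion E) ((algebraMap E (FiniteAdeleRing (𝓞 E) E) δ) w.1))) : ℝ≥0) : ℝ) ^ (-(1 / 2 : ℝ)))) := by
        have h1 : (1 : ℝ) ≤ ∏ v ∈ (S ξ ∪ Sδ) \ S ξ, max 1 (if (∀ w : v.Extension (𝓞 E), normAbs (w.1.adicCompletion E) ((algebraMap E (FiniteAdeleRing (𝓞 E) E) δ) w.1) = 1) ∧ a v = 0 then (1 : ℝ) else ((residueFieldCard (v.adicCompletion F) : ℝ) ^ (-(a v)) + (((letI := Extension.fintype (𝓞 F) F E (𝓞 E) v; ∏ w : v.Extension (𝓞 E), min 1 (normAbs (w.1.adicCompletion E) ((algebraMap E (FiniteAdeleRing (𝓞 E) E) δ) w.1))) : ℝ≥0) : ℝ) ^ (-(1 / 2 : ℝ)))) :=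
          calc (1 : ℝ) = ∏ v ∈ (S ξ ∪ Sδ) \ S ξ, (1 : ℝ) := Finset.prod_const_one.symm
            _ ≤ ∏ v ∈ (S ξ ∪ Sδ) \ S ξ, max 1 (if (∀ w : v.Extension (𝓞 E), normAbs (w.1.adicCompletion E) ((algebraMap E (FiniteAdeleRing (𝓞 E) E) δ) w.1) = 1) ∧ a v = 0 then (1 : ℝ) else ((residueFieldCard (v.adicCompletion F) : ℝ) ^ (-(a v)) + (((letI := Extension.fintype (𝓞 F) F E (𝓞 E) v; ∏ w : v.Extension (𝓞 E), min 1 (normAbs (w.1.adicCompletion E) ((algebraMap E (FiniteAdeleRing (𝓞 E) E) δ) w.1))) : ℝ≥0) : ℝ) ^ (-(1 / 2 : ℝ)))) := Finset.prod_le_prod (fun _ _ => zero_le_one) fun _ _ => le_max_left _ _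
        calc ∏ v ∈ S ξ, (if (∀ w : v.Extension (𝓞 E), normAbs (w.1.adicCompletion E) ((algebraMap E (FiniteAdeleRing (𝓞 E) E) δ) w.1) = 1) ∧ a v = 0 then (1 : ℝ) else ((residueFieldCard (v.adicCompletion F) : ℝ) ^ (-(a v)) + (((letI := Extension.fintype (𝓞 F) F E (𝓞 E) v; ∏ w : v.Extension (𝓞 E), min 1 (normAbs (w.1.adicCompletion E) ((algebraMap E (FiniteAdeleRing (𝓞 E) E) δ) w.1))) : ℝ≥0) : ℝ) ^ (-(1 / 2 : ℝ)))) ≤ ∏ v ∈ S ξ, max 1 (if (∀ w : v.Extension (𝓞 E), normAbs (w.1.adicCompletion E) ((algebraMap E (FiniteAdeleRing (𝓞 E) E) δ) w.1) = 1) ∧ a v = 0 then (1 : ℝ) else ((residueFieldCard (v.adicCompletion F) : ℝ) ^ (-(a v)) + (((letI := Extension.fintype (𝓞 F) F E (𝓞 E) v; ∏ w : v.Extension (𝓞 E), min 1 (normAbs (w.1.adicCompletion E) ((algebraMap E (FiniteAdeleRing (𝓞 E) E) δ) w.1))) : ℝ≥0) : ℝ) ^ (-(1 / 2 : ℝ))))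 := Finset.prod_le_prod (fun v _ => (hBpos v).le) fun v _ => le_max_right _ _
          _ ≤ (∏ v ∈ (S ξ ∪ Sδ) \ S ξ, max 1 (if (∀ w : v.Extension (𝓞 E), normAbs (w.1.adicCompletion E) ((algebraMap E (FiniteAdeleRing (𝓞 E) E) δ) w.1) = 1) ∧ a v = 0 then (1 : ℝ) else ((residueFieldCard (v.adicCompletion F) : ℝ) ^ (-(a v)) + (((letI := Extension.fintype (𝓞 F) F E (𝓞 E) v; ∏ w : v.Extension (𝓞 E), min 1 (normAbs (w.1.adicCompletion E) ((algebraMap E (FiniteAdeleRing (𝓞 E) E) δ) w.1))) : ℝ≥0) : ℝ) ^ (-(1 / 2 : ℝ))))) * ∏ v ∈ S ξ, max 1 (if (∀ w : v.Extension (𝓞 E), normAbs (w.1.adicCompletion E) ((algebraMap E (FiniteAdeleRing (𝓞 E) E) δ) w.1) = 1) ∧ a v = 0 then (1 : ℝ) else ((residueFieldCard (v.adicCompletion F) : ℝ) ^ (-(a v)) + (((letI := Extension.fintype (𝓞 F) F E (𝓞 E) v; ∏ w : v.Extension (𝓞 E), min 1 (normAbs (w.1.adicCompletion E) ((algebraMap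 E (FiniteAdeleRing (𝓞 E) E) δ) w.1))) : ℝ≥0) : ℝ) ^ (-(1 / 2 : ℝ)))) :=
              le_mul_of_one_le_left (Finset.prod_nonneg fun v _ => le_trans zero_le_one (le_max_left _ _)) h1
          _ = ∏ v ∈ S ξ ∪ Sδ, max 1 (if (∀ w : v.Extension (𝓞 E), normAbs (w.1.adicCompletion E) ((algebraMap E (FiniteAdeleRing (𝓞 E) E) δ) w.1) = 1) ∧ a v = 0 then (1 : ℝ) else ((residueFieldCard (v.adicCompletion F) : ℝ) ^ (-(a v)) + (((letI := Extension.fintype (𝓞 F) F E (𝓞 E) v; ∏ w : v.Extension (𝓞 E), min 1 (normAbs (w.1.adicCompletion E) ((algebraMap E (FiniteAdeleRing (𝓞 E) E) δ) w.1))) : ℝ≥0) : ℝ) ^ (-(1 / 2 : ℝ)))) := Finset.prod_sdiff Finset.subset_union_left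
          _ = ∏ v ∈ Sδ, max 1 (if (∀ w : v.Extension (𝓞 E), normAbs (w.1.adicCompletion E) ((algebraMap E (FiniteAdeleRing (𝓞 E) E) δ) w.1) = 1) ∧ a v = 0 then (1 : ℝ) else ((residueFieldCard (v.adicCompletion F) : ℝ) ^ (-(a v)) + (((letI := Extension.fintype (𝓞 F) F E (𝓞 E) v; ∏ w : v.Extension (𝓞 E), min 1 (normAbs (w.1.adicCompletion E) ((algebraMap E (FiniteAdeleRing (𝓞 E) E) δ) w.1))) : ℝ≥0) : ℝ) ^ (-(1 / 2 : ℝ)))) := by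
              refine (Finset.prod_subset Finset.subset_union_right fun v _ hv => ?_).symm
              rw [hB1 v hv, max_self]
      calc ‖∏ v ∈ S ξ, Wc v ξ z‖ = ∏ v ∈ S ξ, ‖Wc v ξ z‖ := norm_prod _ _
        _ ≤ ∏ v ∈ S ξ, (if (∀ w : v.Extension (𝓞 E), normAbs (w.1.adicCompletion E) ((algebraMap E (FiniteAdeleRing (𝓞 E) E) δ) w.1) = 1) ∧ a v = 0 then (1 : ℝ) else ((residueFieldCard (v.adicCompletion F) : ℝ) ^ (-(a v)) + (((letI := Extension.fintype (𝓞 F) F E (𝓞 E) v; ∏ w : v.Extension (𝓞 E), min 1 (normAbs (w.1.adicCompletion E) ((algebraMap E (FiniteAdeleRing (𝓞 E) E) δ) w.1))) : ℝ≥0) : ℝ) ^ (-(1 / 2 : ℝ)))) * (2 * ((n v : ℝ) + 1)) := Finset.prod_le_prod (fun v _ => norm_nonneg _) fun v hv => hWb v ξ (n v) (hn1 v hv) (hn2 v hv) z hz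
        _ = (∏ v ∈ S ξ, (if (∀ w : v.Extension (𝓞 E), normAbs (w.1.adicCompletion E) ((algebraMap E (FiniteAdeleRing (𝓞 E) E) δ) w.1) = 1) ∧ a v = 0 then (1 : ℝ) else ((residueFieldCard (v.adicCompletion F) : ℝ) ^ (-(a v)) + (((letI := Extension.fintype (𝓞 F) F E (𝓞 E) v; ∏ w : v.Extension (𝓞 E), min 1 (normAbs (w.1.adicCompletion E) ((algebraMap E (FiniteAdeleRing (𝓞 E) E) δ) w.1))) : ℝ≥0) : ℝ) ^ (-(1 / 2 : ℝ))))) * ∏ v ∈ S ξ, 2 * ((n v : ℝ) + 1) := Finset.prod_mul_distrib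
        _ ≤ (∏ v ∈ Sδ, max 1 (if (∀ w : v.Extension (𝓞 E), normAbs (w.1.adicCompletion E) ((algebraMap E (FiniteAdeleRing (𝓞 E) E) δ) w.1) = 1) ∧ a v = 0 then (1 : ℝ) else ((residueFieldCard (v.adicCompletion F) : ℝ) ^ (-(a v)) + (((letI := Extension.fintype (𝓞 F) F E (𝓞 E) v; ∏ w : v.Extension (𝓞 E), min 1 (normAbs (w.1.adicCompletion E) ((algebraMap E (FiniteAdeleRing (𝓞 E) E) δ) w.1))) : ℝ≥0) : ℝ) ^ (-(1 / 2 : ℝ))))) * (C₁ * (1 + ‖mixedEmbedding F ξ‖) ^ (2 * finrank ℚ F)) :=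
            mul_le_mul hBprod hcount (Finset.prod_nonneg fun v _ => by positivity) (Finset.prod_nonneg fun v _ => le_trans zero_le_one (le_max_left _ _))
        _ = (∏ v ∈ Sδ, max 1 (if (∀ w : v.Extension (𝓞 E), normAbs (w.1.adicCompletion E) ((algebraMap E (FiniteAdeleRing (𝓞 E) E) δ) w.1) = 1) ∧ a v = 0 then (1 : ℝ) else ((residueFieldCard (v.adicCompletion F) : ℝ) ^ (-(a v)) + (((letI := Extension.fintype (𝓞 F) F E (𝓞 E) v; ∏ w : v.Extension (𝓞 E), min 1 (normAbs (w.1.adicCompletion E) ((algebraMap E (FiniteAdeleRing (𝓞 E) E) δ) w.1))) : ℝ≥0) : ℝ) ^ (-(1 / 2 : ℝ))))) * C₁ * (1 + ‖mixedEmbedding F ξ‖) ^ (2 * finrank ℚ F) := by ring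
  · -- (supp)
    show ∏ v ∈ S ξ, Wc v ξ z = 0
    obtain ⟨v, hv⟩ := hv
    have hvS : v ∈ S ξ := by
      by_contra hvS
      obtain ⟨hv0, hη⟩ := hSout hξ v hvS
      apply hv
      have h1 : normAbs (v.adicCompletion F) (ξ : v.adicCompletion F) = 1 := by
        have h := hη
        rw [map_mul, ho v, hS₀o v hv0, zpow_zero, mul_one] at h
        exact h
      rw [mem_primePowBall_iff, h1, show e v = 0 by simp only [e, hS₀m v hv0, hS₀a v hv0, hS₀o v hv0, sub_zero], zpow_zero]
    have hz0 : Wc v ξ = 0 := hWz v ξ fun h => hv (by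
      have h' := (hdict ξ v _).1 h
      rwa [show m v - a v - o v = e v by simp only [e]] at h')
    exact Finset.prod_eq_zero hvS (by rw [hz0]; rfl)

end Summit.HodgeConjecture.HodgeConjecture.Cruxes.H413.K2E1WhittakerFinitePartU2

end
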